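import Literature.NumberTheory.NumberFields.RayClassFieldAdicCharacterTower
import Literature.NumberTheory.NumberFields.RayClassFieldSplitPrimePowerDegreeQuadratic
import Literature.NumberTheory.EllipticCurves.ProfiniteGroupDistributionCharacterCells
import HarnessLib

/-!
# Composability certificate: the GLOBAL ray class tower `Gal(K̄/K(𝔪'v^{n+1}))` with `κ_p = e ∘ κ` feeds
# the measure side's cell maps and pull-back integrals BY NAME — de Shalit's (10) on `Gal(K̄/K(𝔪))`
# (I.3.3 (9)–(10), II.4.6–4.7; part 6)

De Shalit 1987, II.4.6 (p. 59) / I.3.4 (10) (p. 18): the measures `μ_β` on `ℤ_p^×` are pulled back to the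
Galois group along `κ : Gal(K(𝔣𝔭^∞)/K(𝔣)) ≅ ℤ_pˣ` and integrated coset by coset:
`∫_G 𝟙_{G_0}(σ) g(κσ) dD_β(σ) = ∫_{ℤ_p^×} g dμ_β`. The tree's `ProfiniteGroupDistributionCharacterCells.lean`
(p719000) proves this for an ABSTRACT `(G, 𝒰, κ)` under `hU`/`hκ`; parts 1–3
(`RayClassFieldAdicArtinValue/Character/CharacterTower.lean`) built, by class field theory, the concrete
`G = Gal(K̄/K(𝔪))`, `𝒰 = rayAdicTower h𝔪' v` (`U_n = Gal(K̄/K(𝔪'v^{n+1}))`), `κ_p = e ∘ rayAdicCharacter`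
with `hU` (`mem_rayAdicTower_iff`) and `hκ` (`exists_toZModPow_padicRayAdicCharacter_eq`) VERBATIM. THIS
FILE is the certificate that they compose with p719000 by name, plus the `w_𝔪 = 1` discharge for the
route's field:

* `hw_of_natCard_units_eq_two` — for `#𝓞_Kˣ = 2` (every imaginary quadratic `K` with `d_K < −4`, e.g.
  `ℚ(√−7)`): `2 ∉ 𝔪 → w_𝔪 = 1` (the hypothesis `hw` of `rayAdicCharacter`; at `p = 2` split this excludes
  exactly the moduli dividing `2`, e.g. `𝔪 = 𝔭̄`, and admits `𝔭̄²`, `𝔤𝔭̄` — de Shalit's `𝔣 = 𝔤𝔭̄^m`, `m`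
  large);
* `exists_rayAdicCellMap` — the cell maps `ψ_n : G ⧸ U_n → ℤ/p^{n+1}`, `ψ_n(σU_n) = κ_p(σ) mod p^{n+1}`
  on `U_0`, EXIST (`SubgroupTower.exists_cellMap_of_character` with `hU := mem_rayAdicTower_iff`);
* ★ `integral_comap_restrictUnits_rayAdicTower` — **de Shalit's (10) on the global tower at `p = 2`**:
  for every bounded distribution `ν` on `ℤ_2` and uniformly continuous `g`,
  `∫_G 𝟙_{U_0}(σ) g(κ_2 σ) d(comap ν|_{ℤ_2^×})(σ) = ∫_{ℤ_2^×} g dν`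
  (`GroupDistribution.integral_comap_restrictUnits_of_character_two` fed with `mem_rayAdicTower_iff` and
  `exists_toZModPow_padicRayAdicCharacter_eq`).

Everything is a theorem; no definitions, no named facts, no instances, no `sorry`. The levels of
`rayAdicTower` are normal (`rayAdicTower_U_normal`); the normality instance is a binder.

## References

* [deShalit1987] E. de Shalit, *Iwasawa theory of elliptic curves with complex multiplication* (1987),
  I.3.3 (9), I.3.4 (10) (p. 17–18), II.1.9 (p. 43), II.4.6–4.7 (p. 59–60).
-/

noncomputable section

open NumberField IsDedekindDomain IsDedekindDomain.HeightOneSpectrum Field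
open scoped nonZeroDivisors Classical

namespace Literature.NumberTheory.NumberFields

open Literature.NumberTheory.GaloisRepresentations
open Literature.NumberTheory.EllipticCurves

variable {K : Type} [Field K] [NumberField K]

/-! ### §9. `w_𝔪 = 1` for `#𝓞_Kˣ = 2`; the cell maps; de Shalit's (10) on the global tower -/

section Cells

variable {𝔪 𝔪' : Ideal (𝓞 K)} {v : HeightOneSpectrum (𝓞 K)}

/-- **`w_𝔪 = 1` when `#𝓞_Kˣ = 2` and `2 ∉ 𝔪`** — the hypothesis `hw` of `rayAdicCharacter` for every
imaginary quadratic `K` with `d_K < −4` (`RayClassFieldSplitPrimePowerDegreeQuadratic.lean`).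
[cite: deShalit1987, II.1.9 (p. 43)] -/
theorem hw_of_natCard_units_eq_two (hunits : Nat.card (𝓞 K)ˣ = 2) (h2 : (2 : 𝓞 K) ∉ 𝔪) :
    ∀ u : (𝓞 K)ˣ, (u : 𝓞 K) - 1 ∈ 𝔪 → u = 1 :=
  units_eq_one_of_sub_one_mem_of_natCard_eq_two hunits h2

variable [IsTotallyComplex K] (h𝔪' : 𝔪' ≠ ⊥) (h𝔪 : 𝔪 ≠ ⊥) (hv : ¬ 𝔪 ≤ v.asIdeal)
  (hw : ∀ u : (𝓞 K)ˣ, (u : 𝓞 K) - 1 ∈ 𝔪 → u = 1) {p : ℕ} [hp : Fact p.Prime]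
  (e : v.adicCompletionIntegers K ≃+* ℤ_[p]) (hle : 𝔪' ≤ 𝔪) (hv' : ¬ 𝔪' ≤ v.asIdeal)

include hle hv' in
/-- **The cell maps of the global ray class tower exist**: `ψ_n : G ⧸ U_n → ℤ/p^{n+1}` with
`ψ_n(σU_n) = κ_p(σ) mod p^{n+1}` on `U_0` — `SubgroupTower.exists_cellMap_of_character` with
`hU := mem_rayAdicTower_iff`; with them `cellMap_trans/_injective/_fiberSurj`,
`comap_family_equivariant_of_character`, `integral_comap_of_character` apply to
`(rayAdicTower h𝔪' v, κ_p)` by name, `hκ` being `exists_toZModPow_padicRayAdicCharacter_eq`.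
[cite: deShalit1987, I.3.3 (9), I.3.4 (10) (p. 18), II.4.6 (p. 59)] -/
theorem exists_rayAdicCellMap :
    ∃ ψ : (n : ℕ) → ↥(absRestrictNormalHom (rayClassField K 𝔪)).ker ⧸ (rayAdicTower (𝔪 := 𝔪) h𝔪' v).U n →
        ZMod (p ^ (n + 1)),
      ∀ (n : ℕ) (σ : ↥(absRestrictNormalHom (rayClassField K 𝔪)).ker), σ ∈ (rayAdicTower (𝔪 := 𝔪) h𝔪' v).U 0 →
        ψ n ((rayAdicTower (𝔪 := 𝔪) h𝔪' v).proj n σ) = PadicInt.toZModPow (n + 1)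
          (((Units.map (e : v.adicCompletionIntegers K →+* ℤ_[p]).toMonoidHom).comp
            (rayAdicCharacter h𝔪 hv hw) σ : ℤ_[p]ˣ) : ℤ_[p]) :=
  (rayAdicTower (𝔪 := 𝔪) h𝔪' v).exists_cellMap_of_character _ (mem_rayAdicTower_iff h𝔪' h𝔪 hv hw e hle hv')

end Cells

section Two

variable [IsTotallyComplex K] {𝔪 𝔪' : Ideal (𝓞 K)} {v : HeightOneSpectrum (𝓞 K)}
  (h𝔪' : 𝔪' ≠ ⊥) [∀ n, ((rayAdicTower (𝔪 := 𝔪) h𝔪' v).U n).Normal] (h𝔪 : 𝔪 ≠ ⊥)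
  (hv : ¬ 𝔪 ≤ v.asIdeal) (hw : ∀ u : (𝓞 K)ˣ, (u : 𝓞 K) - 1 ∈ 𝔪 → u = 1)
  (e₂ : v.adicCompletionIntegers K ≃+* ℤ_[2]) (hle : 𝔪' ≤ 𝔪) (hv' : ¬ 𝔪' ≤ v.asIdeal)

include hle hv' in
/-- ★ **De Shalit's (10) on the global ray class tower at `p = 2`**: for any bounded distribution `ν` on
`ℤ_2`, any cell maps `ψ` with `ψ_n(σU_n) = κ_2(σ) mod 2^{n+1}` on `U_0` (`exists_rayAdicCellMap`) and any
uniformly continuous `g`, the pull-back of `ν|_{ℤ_2^×}` to `G = Gal(K̄/K(𝔪))` along `ψ` integrates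
`σ ↦ 𝟙_{U_0}(σ) g(κ_2 σ)` to `∫ g d(ν|_{ℤ_2^×})` — `GroupDistribution.integral_comap_restrictUnits_of_character_two`
fed with `mem_rayAdicTower_iff` (`hU`) and `exists_toZModPow_padicRayAdicCharacter_eq` (`hκ`): the
measure `μ_β` of II.4.6 pulled back to `Gal(K̄/K(𝔣𝔭))` by `κ`, at the split prime `2`.
[cite: deShalit1987, I.3.4 (10) (p. 18), II.4.6 (14) (p. 59)] -/
theorem integral_comap_restrictUnits_rayAdicTower {𝕜 : Type*} [NormedField 𝕜] [IsUltrametricDist 𝕜]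
    [CompleteSpace 𝕜] (ν : BoundedDistribution (ProfiniteTower.padicInt 2) 𝕜)
    (ψ : (n : ℕ) → ↥(absRestrictNormalHom (rayClassField K 𝔪)).ker ⧸ (rayAdicTower (𝔪 := 𝔪) h𝔪' v).U n →
      ZMod (2 ^ (n + 1)))
    (hψ : ∀ (n : ℕ) (σ : ↥(absRestrictNormalHom (rayClassField K 𝔪)).ker),
      σ ∈ (rayAdicTower (𝔪 := 𝔪) h𝔪' v).U 0 →
        ψ n ((rayAdicTower (𝔪 := 𝔪) h𝔪' v).proj n σ) = PadicInt.toZModPow (n + 1)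
          (((Units.map (e₂ : v.adicCompletionIntegers K →+* ℤ_[2]).toMonoidHom).comp
            (rayAdicCharacter h𝔪 hv hw) σ : ℤ_[2]ˣ) : ℤ_[2]))
    {g : ℤ_[2] → 𝕜} (hg : UniformContinuous g) :
    (GroupDistribution.comap (restrictUnits ν) ψ
        ((rayAdicTower (𝔪 := 𝔪) h𝔪' v).cellMap_trans _ ψ hψ)
        ((rayAdicTower (𝔪 := 𝔪) h𝔪' v).cellMap_injective _ (mem_rayAdicTower_iff h𝔪' h𝔪 hv hw e₂ hle hv') ψ hψ)
        ((rayAdicTower (𝔪 := 𝔪) h𝔪' v).cellMap_fiberSurj _ (mem_rayAdicTower_iff h𝔪' h𝔪 hv hw e₂ hle hv')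
          (exists_toZModPow_padicRayAdicCharacter_eq h𝔪' h𝔪 hv hw e₂ hle hv') ψ hψ)).integral
        (fun σ ↦ (if (rayAdicTower (𝔪 := 𝔪) h𝔪' v).proj 0 σ = 1 then (1 : 𝕜) else 0) *
          g ((((Units.map (e₂ : v.adicCompletionIntegers K →+* ℤ_[2]).toMonoidHom).comp
            (rayAdicCharacter h𝔪 hv hw) σ : ℤ_[2]ˣ) : ℤ_[2]))) =
      (restrictUnits ν).integral g :=
  GroupDistribution.integral_comap_restrictUnits_of_character_two _ ν (mem_rayAdicTower_iff h𝔪' h𝔪 hv hw e₂ hle hv')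
    (exists_toZModPow_padicRayAdicCharacter_eq h𝔪' h𝔪 hv hw e₂ hle hv') ψ hψ hg

end Two

end Literature.NumberTheory.NumberFields

end
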